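import Summits.BirchSwinnertonDyer.BirchSwinnertonDyer.Theorems.KimAtThreeDeepLowerKatoLit
import Summits.BirchSwinnertonDyer.BirchSwinnertonDyer.Theorems.KimAtThreeDeepLowerKatoExactFinal
import HarnessLib

/-!
# Crux `DeepUpperAtThree` (stmt-BirchSwinnertonDyer-19076) BY NAME from CITE-ONLY named facts
# (route `KimAtThreeKolyvagin`, rung W2 of `BirchSwinnertonDyer`; cell `bsd-addord`, seat w2-c3 gen 10 = LEAD of 19076)

HONEST FRAMING.  TWO composition theorems (no definition, no instance, no `sorry`).  The conclusion of the first is the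
route declaration `Summit.BirchSwinnertonDyer.BirchSwinnertonDyer.Theses.KimAtThreeKolyvagin.DeepUpperAtThree` BY NAME; its
TEN hypotheses are all cite-only NAMED STATEMENTS (unproved published results, D-0014: the four held-PUB route leaves of
`Theses/KimAtThreeKolyvagin` and six `Literature/` facts), so the theorem is CONDITIONAL (the gate records
`conditional-result`): the four route leaves `SakamotoKolyvaginThree` [Sakamoto 2024
Thm. 4.4], `RankEqAnalyticRankLeOne` [Gross–Zagier–Kolyvagin], `PoitouTateSelmerDuality` [Poitou–Tate / Mazur–Rubin],
`CarayolLevelEqConductor` [Carayol 1986]; the five `p`-adic Hodge facts of `PAdicHodge/DualExpElliptic{,Tower}`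
(P123) `cupLogInjective_and_hasDualExp_of_isDeRham` [Kato II Prop. 1.2.3], (DR) `isDeRham_restrictedRationalTateRep`
[Kato II Ex. 1.3.5], (S5a) `expStarCoord_eq_zero_iff_kummer` [BK90 3.8/3.11], (S5b)
`exists_smul_range_expStarCoord_iff_trace_log`, (S5b-tower) `exists_smul_range_expStarCoord_tower_iff_trace_log`
[Kato II Thm. 1.4.1 + BK90 3.8]; and the Kato fact `Kato2004.exists_eulerSystem_definedExpStar_values` [Kato 2004
(8.1.3)/Ex. 13.3, Prop. 8.12, §9.4, Thm. 9.7, Thm. 6.6 (1) over the DEFINED dual exponential; typed by w2-c2 g9].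
NOTHING ELSE is displayed: every construction-shaped input of the crux (Kato's Euler system → Kolyvagin system at `3`
on every reduction type, the local lattice `exp*_ω(H¹(ℚ₃, T))`, the moment-calculus dictionary, the stub at the empty
level, the off-stratum rows) is a kernel theorem of the cell (seats w2-c3 gens 0–9, w2-c2, kim3, w2-c4, w2-c5,
w2-acc1–5, w2-kport, w2-tamdiv; files `Theorems/KimAtThreeDeepUpper*`, `…DeepLower*`, `…FineKato*`, `…Kolyvagin*`).
The item is closed by the planner's `workitem close … --as proved --by` on the cell's cite-only convention; BSD is NOT
proved by any of this («closes rung 19076 of BirchSwinnertonDyer» modulo the cited facts, never summit credit).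

Proof: w2-c2's bridge `KimAtThreeDeepLowerKatoLit.katoExact_of_lit : (P123) → (DR) → Kato-defined → hKatoExᵘ` composed
with w2-c2's `KimAtThreeDeepLowerKatoExactFinal.deepLower_and_deepUpper_of_katoExact_of_facts` (which composes this
seat's gen-8 lattice discharge `hLat_of_facts` and gens 5–9 deep-family glue), second component.

References: [Kim2025RefinedTNC] Thm. 1.1; [Sakamoto2024] Thm. 4.4; [MazurRubin2004] Thm. 5.2.12; [Carayol1986];
[Kato2004Asterisque] (8.1.3), Prop. 8.12, §9.4, Thm. 9.7, Thm. 6.6 (1), Ex. 13.3; [Kato1993LNM1553] II Prop. 1.2.3,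
§1.2.4, Ex. 1.3.5, Thm. 1.4.1; [BlochKato1990] §3 Prop. 3.8, Ex. 3.11.
-/

noncomputable section

-- the cell's Theorems namespace `Summit.BirchSwinnertonDyer.BirchSwinnertonDyer.…` repeats the summit name by design (D-0017)
set_option linter.dupNamespace false

open Literature.NumberTheory.EllipticCurves Literature.NumberTheory.EllipticCurves.Rank1Residual
open Literature.NumberTheory.GaloisRepresentations Literature.NumberTheory.PAdicHodge
open Literature.NumberTheory.EllipticCurves.Kato2004
open Summit.BirchSwinnertonDyer.Rank1Residual.Additive
open Summit.BirchSwinnertonDyer.BirchSwinnertonDyer.Theses.KimAtThreeKolyvagin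
open Summit.BirchSwinnertonDyer.BirchSwinnertonDyer.Theorems.KimAtThreeDeepLowerKatoLit
open Summit.BirchSwinnertonDyer.BirchSwinnertonDyer.Theorems.KimAtThreeDeepLowerKatoExactFinal

namespace Summit.BirchSwinnertonDyer.BirchSwinnertonDyer.Theorems.KimAtThreeDeepUpperCiteOnly

/-- ★★ **Crux `DeepUpperAtThree` (19076) BY NAME from cite-only named facts**: the Kato-side UPPER half
`ord₃ #Ш(E/ℚ)[3^∞] + ∂^{(∞)}_deep(δ̃) ≤ ∂^{(0)}(δ̃)` for every `3`-adic-tower-surjective `E/ℚ` with finite `Ш` and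
`3`-integral plus symbols and `∂^{(0)}`-vanishing order `0`, from Kato's Euler system with DEFINED `exp*` (Literature fact),
Kato II / Bloch–Kato `p`-adic Hodge facts, Sakamoto's `p = 3` Kolyvagin systems, Gross–Zagier–Kolyvagin, Poitou–Tate
and Carayol — all displayed as named-fact hypotheses (CONDITIONAL). [cite: Kim2025RefinedTNC, Thm 1.1]
[cite: Kato2004Asterisque, (8.1.3) (p. 180), Prop. 8.12 (p. 186), §9.4 and Thm. 9.7 (pp. 188–189), Thm. 6.6 (1) (p. 163), Ex. 13.3 (pp. 224–225)]
[cite: Sakamoto2024, Thm. 4.4 (p. 926)] [cite: MazurRubin2004, Thm. 5.2.12] [cite: Carayol1986]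
[cite: Kato1993LNM1553, Ch. II Prop. 1.2.3, §1.2.4 and Thm. 1.4.1] [cite: BlochKato1990, §3 Prop. 3.8 and Ex. 3.11] -/
theorem deepUpperAtThree_of_lit_of_facts
    (hLit : Kato2004.exists_eulerSystem_definedExpStar_values)
    (hSak : SakamotoKolyvaginThree) (hGZK : RankEqAnalyticRankLeOne) (hPT : PoitouTateSelmerDuality)
    (hlev : CarayolLevelEqConductor)
    (hP : cupLogInjective_and_hasDualExp_of_isDeRham) (hDR : isDeRham_restrictedRationalTateRep)
    (hS : expStarCoord_eq_zero_iff_kummer) (hT : exists_smul_range_expStarCoord_iff_trace_log)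
    (hT₂ : exists_smul_range_expStarCoord_tower_iff_trace_log) :
    Summit.BirchSwinnertonDyer.BirchSwinnertonDyer.Theses.KimAtThreeKolyvagin.DeepUpperAtThree :=
  (deepLower_and_deepUpper_of_katoExact_of_facts (katoExact_of_lit hP hDR hLit) hSak hGZK hPT hP hDR hS hT hT₂ hlev).2

/-- ★ **Cruxes `DeepLowerAtThree ∧ DeepUpperAtThree` (19075 ∧ 19076) BY NAME from the same cite-only facts** (for the
record; the lower half is w2-c2's item). Conditional. [cite: Kim2025RefinedTNC, Thm 1.1] [cite: Sakamoto2024, Thm. 4.4 (p. 926)]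
[cite: Kato2004Asterisque, §9.4 and Thm. 9.7 (pp. 188–189)] -/
theorem deepLower_and_deepUpper_of_lit_of_facts
    (hLit : Kato2004.exists_eulerSystem_definedExpStar_values)
    (hSak : SakamotoKolyvaginThree) (hGZK : RankEqAnalyticRankLeOne) (hPT : PoitouTateSelmerDuality)
    (hlev : CarayolLevelEqConductor)
    (hP : cupLogInjective_and_hasDualExp_of_isDeRham) (hDR : isDeRham_restrictedRationalTateRep)
    (hS : expStarCoord_eq_zero_iff_kummer) (hT : exists_smul_range_expStarCoord_iff_trace_log)
    (hT₂ : exists_smul_range_expStarCoord_tower_iff_trace_log) :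
    Summit.BirchSwinnertonDyer.BirchSwinnertonDyer.Theses.KimAtThreeKolyvagin.DeepLowerAtThree ∧
      Summit.BirchSwinnertonDyer.BirchSwinnertonDyer.Theses.KimAtThreeKolyvagin.DeepUpperAtThree :=
  deepLower_and_deepUpper_of_katoExact_of_facts (katoExact_of_lit hP hDR hLit) hSak hGZK hPT hP hDR hS hT hT₂ hlev

/-! ### The other decls of the deep leaf, BY NAME from the same cite-only statements (w2-c2's items 19075 / 19679 / 20013,
w2-c5's 19562, and the leaf `N11.KimAtThreeDeepPUB`; one-line compositions of w2-c2's `…_of_katoExact_of_facts` with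
`katoExact_of_lit`, recorded here so that every CLOSE-ASK has a standalone declaration) -/

/-- **Crux `DeepLowerAtThree` (19075, w2-c2's item) BY NAME from cite-only statements.** Conditional.
[cite: Kim2025RefinedTNC, Thm 1.1] [cite: Sakamoto2024, Thm. 4.4 (p. 926)] [cite: Kato2004Asterisque, §9.4 and Thm. 9.7 (pp. 188–189)] -/
theorem deepLowerAtThree_of_lit_of_facts
    (hLit : Kato2004.exists_eulerSystem_definedExpStar_values)
    (hSak : SakamotoKolyvaginThree) (hGZK : RankEqAnalyticRankLeOne) (hPT : PoitouTateSelmerDuality)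
    (hlev : CarayolLevelEqConductor)
    (hP : cupLogInjective_and_hasDualExp_of_isDeRham) (hDR : isDeRham_restrictedRationalTateRep)
    (hS : expStarCoord_eq_zero_iff_kummer) (hT : exists_smul_range_expStarCoord_iff_trace_log)
    (hT₂ : exists_smul_range_expStarCoord_tower_iff_trace_log) :
    Summit.BirchSwinnertonDyer.BirchSwinnertonDyer.Theses.KimAtThreeKolyvagin.DeepLowerAtThree :=
  deepLowerAtThree_of_katoExact_of_facts (katoExact_of_lit hP hDR hLit) hSak hGZK hPT hP hDR hS hT hT₂ hlev

/-- **Crux `DeepLowerAtThreeOffKatoStratum` (19679, w2-c2's item) BY NAME from cite-only statements.** Conditional.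
[cite: Kim2025RefinedTNC, Thm 1.1] [cite: Sakamoto2024, Thm. 4.4 (p. 926)] -/
theorem deepLowerAtThreeOffKatoStratum_of_lit_of_facts
    (hLit : Kato2004.exists_eulerSystem_definedExpStar_values)
    (hSak : SakamotoKolyvaginThree) (hGZK : RankEqAnalyticRankLeOne) (hPT : PoitouTateSelmerDuality)
    (hP : cupLogInjective_and_hasDualExp_of_isDeRham) (hDR : isDeRham_restrictedRationalTateRep)
    (hS : expStarCoord_eq_zero_iff_kummer) (hT : exists_smul_range_expStarCoord_iff_trace_log)
    (hT₂ : exists_smul_range_expStarCoord_tower_iff_trace_log) :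
    Summit.BirchSwinnertonDyer.BirchSwinnertonDyer.Theses.KimAtThreeKolyvagin.DeepLowerAtThreeOffKatoStratum :=
  deepLowerAtThreeOffKatoStratum_of_katoExact_of_facts (katoExact_of_lit hP hDR hLit) hSak hGZK hPT hP hDR hS hT hT₂

/-- **Crux `DeepUpperAtThreeOffKatoStratum` (19562) BY NAME from cite-only statements.** Conditional.
[cite: Kim2025RefinedTNC, Thm 1.1] [cite: Sakamoto2024, Thm. 4.4 (p. 926)] -/
theorem deepUpperAtThreeOffKatoStratum_of_lit_of_facts
    (hLit : Kato2004.exists_eulerSystem_definedExpStar_values)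
    (hSak : SakamotoKolyvaginThree) (hGZK : RankEqAnalyticRankLeOne) (hPT : PoitouTateSelmerDuality)
    (hP : cupLogInjective_and_hasDualExp_of_isDeRham) (hDR : isDeRham_restrictedRationalTateRep)
    (hS : expStarCoord_eq_zero_iff_kummer) (hT : exists_smul_range_expStarCoord_iff_trace_log)
    (hT₂ : exists_smul_range_expStarCoord_tower_iff_trace_log) :
    Summit.BirchSwinnertonDyer.BirchSwinnertonDyer.Theses.KimAtThreeKolyvagin.DeepUpperAtThreeOffKatoStratum :=
  deepUpperAtThreeOffKatoStratum_of_katoExact_of_facts (katoExact_of_lit hP hDR hLit) hSak hGZK hPT hP hDR hS hT hT₂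

/-- **Support item `DefinedKatoUniformThree` (20013) BY NAME from cite-only statements.** Conditional.
[cite: Kato2004Asterisque, §9.4 and Thm. 9.7 (pp. 188–189)] [cite: BlochKato1990, §3 (Prop. 3.8, Ex. 3.11)] -/
theorem definedKatoUniformThree_of_lit_of_facts
    (hLit : Kato2004.exists_eulerSystem_definedExpStar_values)
    (hP : cupLogInjective_and_hasDualExp_of_isDeRham) (hDR : isDeRham_restrictedRationalTateRep)
    (hS : expStarCoord_eq_zero_iff_kummer) (hT : exists_smul_range_expStarCoord_iff_trace_log)
    (hT₂ : exists_smul_range_expStarCoord_tower_iff_trace_log) :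
    Summit.BirchSwinnertonDyer.BirchSwinnertonDyer.Theses.KimAtThreeKolyvagin.DefinedKatoUniformThree :=
  definedKatoUniformThree_of_katoExact_of_facts (katoExact_of_lit hP hDR hLit) hP hDR hS hT hT₂

/-- ★★ **The route leaf `N11.KimAtThreeDeepPUB` BY NAME from cite-only statements** (the deep form of B3 = N11@3).
Conditional; nothing booked. [cite: Kim2025RefinedTNC, Thm 1.1] [cite: Kim2022StructureSelmer, Thm. 1.9 (6), Thm. 3.13]
[cite: Sakamoto2024, Thm. 4.4 (p. 926)] [cite: Kato2004Asterisque, §9.4 and Thm. 9.7 (pp. 188–189)] -/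
theorem kimAtThreeDeepPUB_of_lit_of_facts
    (hLit : Kato2004.exists_eulerSystem_definedExpStar_values)
    (hSak : SakamotoKolyvaginThree) (hGZK : RankEqAnalyticRankLeOne) (hPT : PoitouTateSelmerDuality)
    (hlev : CarayolLevelEqConductor)
    (hP : cupLogInjective_and_hasDualExp_of_isDeRham) (hDR : isDeRham_restrictedRationalTateRep)
    (hS : expStarCoord_eq_zero_iff_kummer) (hT : exists_smul_range_expStarCoord_iff_trace_log)
    (hT₂ : exists_smul_range_expStarCoord_tower_iff_trace_log) : N11.KimAtThreeDeepPUB :=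
  kimAtThreeDeepPUB_of_katoExact_of_facts (katoExact_of_lit hP hDR hLit) hSak hGZK hPT hP hDR hS hT hT₂ hlev

end Summit.BirchSwinnertonDyer.BirchSwinnertonDyer.Theorems.KimAtThreeDeepUpperCiteOnly

end
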